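import Summits.CriticalPhenomena.PercolationContinuityZ3.Theorems.PercNearOneGluingNoHeavyLowerTailAntitheticOneSum
import HarnessLib

/-!
# `NoHeavyLowerTail` (stmt-CriticalPhenomena-4575) — antithetic cluster pairs: the 1-SUM LEMMA for the VERTEX ANTITHETIC INEQUALITY itself
# (CONJECTURE BIC, vertex version, is stable under hanging any graph at any vertex; prim-hp-2 gen 64, HOME/MEMO-gen64.md §1)

Support file (`--supports stmt-CriticalPhenomena-4575`, hull-port prover `prim-hp-2`, gen 64).  No definitions, no named facts, no sorries;
standard axioms.  VERTEX version; setting of …AntitheticOneSum (`E₁, E₂` disjoint, glued at one vertex `a`, source on the `E₁` side).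

The 1-SUM LEMMA of …AntitheticOneSum transports positivity statements quantified over ALL twisted-monotone super-odd test functions.  The
vertex antithetic inequality `BIC_E(R) = Σ_{ω : no r ∈ R in X_E ω ∩ Y_E ω} (F(X_E ω) − F(Y_E ω))(G(X_E ω) − G(Y_E ω)) ≥ 0` is quantified over
the smaller class of DIFFERENCES of monotone set functions; the same proof goes through because the cube average of a lifted difference
`F(Φ_T P) − F(Ψ_T Q)` over an EXACTLY antipodal cube (`Ψ_{Tᶜ} = Φ_T`, as for red/blue clusters) is again a difference `F̃(P) − F̃(Q)`.
* `Antithetic.lift_composition_diff_nonneg` — the abstract lemma for the difference class.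
* `Antithetic.OneSum.double_sum_eq` — the doubling identity behind both 1-sum lemmas: for ANY pair functional `Ψ` and any event depending
  on `ω ∩ E₁`, `|Set (Sym2 V)| · Σ_{ω : pred} Ψ(X ω, Y ω) = Σ_{ω₁ : pred} Σ_{ω₂} Ψ(L(X₁ ω₁, C_a(ω₂ ∩ E₂)), L(Y₁ ω₁, C_a(ω₂ᶜ ∩ E₂)))`
  (`L(P, S) = P ∪ {u | a ∈ P ∧ u ∈ S}` the conditional lift).
* `Antithetic.OneSum.vertex_sum_nonneg` — **BIC IS 1-SUM STABLE (vertex version)**: `R` a set of vertices of the `E₁` side; if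
  `BIC_{E₁}(R) ≥ 0` for all monotone `F, G` then `BIC_{E₁ ∪ E₂}(R) ≥ 0` for all monotone `F, G`.  So every vertex antithetic theorem of the
  programme (THEOREM Θ, Θ², K4H, W4H, the handle theorems at `R = {x}`, …) extends to the same graph with arbitrary finite graphs hung at any
  of its vertices — including the arm vertices and `x` itself; the edge-cluster block-gluing theorem of gen 39 (…AntitheticBlockGluing, sinks and
  `R` on both sides) is the two-sided edge-version ancestor.
[cite: VandenbergHaggstromKahn2005, §1 p. 6 ("Harris' inequality"), §1 p. 3 (open cluster `C_s`)]
-/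

noncomputable section

namespace Summit.CriticalPhenomena.PercolationContinuityZ3.Theorems

open Literature.Probability.Percolation
open scoped Classical

namespace Antithetic

/-- **Lift composition for differences.**  Side 1: a sub-family `{j | p j}` of pairs `(P₁ j, Q₁ j)` with
`Σ_j (F(P₁ j) − F(Q₁ j))(G(P₁ j) − G(Q₁ j)) ≥ 0` for all monotone `F, G`.  Side 2: lift maps `Φ T` (monotone in the set and in `T`) and
`Ψ T` (antitone in `T`), EXACTLY antipodal (`Ψ Tᶜ P = Φ T P`).  Then `Σ_j Σ_T (F(Φ T (P₁ j)) − F(Ψ T (Q₁ j)))(G(…) − G(…)) ≥ 0` for all monotone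
`F, G`. [this work] -/
theorem lift_composition_diff_nonneg {V ι J : Type*} [Fintype ι] [Fintype J] (p : J → Prop) [DecidablePred p] (P₁ Q₁ : J → Set V)
    (hplus : ∀ F G : Set V → ℝ, Monotone F → Monotone G →
      0 ≤ ∑ j ∈ Finset.univ.filter (fun j => p j), (F (P₁ j) - F (Q₁ j)) * (G (P₁ j) - G (Q₁ j)))
    (Φ Ψ : Set ι → Set V → Set V) (hΦP : ∀ T, Monotone (Φ T))
    (hΦT : ∀ P, Monotone (fun T => Φ T P)) (hΨT : ∀ Q, Antitone (fun T => Ψ T Q)) (hanti : ∀ T P, Ψ Tᶜ P = Φ T P)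
    {F G : Set V → ℝ} (hF : Monotone F) (hG : Monotone G) :
    0 ≤ ∑ j ∈ Finset.univ.filter (fun j => p j), ∑ T : Set ι,
      (F (Φ T (P₁ j)) - F (Ψ T (Q₁ j))) * (G (Φ T (P₁ j)) - G (Ψ T (Q₁ j))) := by
  -- the cube-averaged set functions
  let Fs : Set V → ℝ := fun P => ∑ T : Set ι, F (Φ T P)
  let Gs : Set V → ℝ := fun P => ∑ T : Set ι, G (Φ T P)
  have hFs : Monotone Fs := fun P P' h => Finset.sum_le_sum fun T _ => hF (hΦP T h)
  have hGs : Monotone Gs := fun P P' h => Finset.sum_le_sum fun T _ => hG (hΦP T h)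
  have hsumc : ∀ (c : Set ι → ℝ), ∑ T : Set ι, c Tᶜ = ∑ T : Set ι, c T := fun c =>
    Fintype.sum_equiv (Equiv.mk compl compl compl_compl compl_compl) _ _ fun T => rfl
  -- exact antipodality: the `Ψ`-average is the `Φ`-average
  have hΨavg : ∀ (H : Set V → ℝ) (Q : Set V), ∑ T : Set ι, H (Ψ T Q) = ∑ T : Set ι, H (Φ T Q) := by
    intro H Q
    rw [← hsumc (fun T => H (Ψ T Q))]
    exact Finset.sum_congr rfl fun T _ => by rw [hanti]
  have hpos := hplus Fs Gs hFs hGs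
  have hN : (0 : ℝ) < (Fintype.card (Set ι) : ℝ) := by exact_mod_cast Fintype.card_pos
  -- Harris in `T` for each `j`
  have hj : ∀ j, (Fs (P₁ j) - Fs (Q₁ j)) * (Gs (P₁ j) - Gs (Q₁ j)) ≤ (Fintype.card (Set ι) : ℝ) *
      ∑ T : Set ι, (F (Φ T (P₁ j)) - F (Ψ T (Q₁ j))) * (G (Φ T (P₁ j)) - G (Ψ T (Q₁ j))) := by
    intro j
    have e1 : Fs (P₁ j) - Fs (Q₁ j) = ∑ T : Set ι, (F (Φ T (P₁ j)) - F (Ψ T (Q₁ j))) := by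
      show (∑ T : Set ι, F (Φ T (P₁ j))) - (∑ T : Set ι, F (Φ T (Q₁ j))) = _
      rw [← hΨavg F (Q₁ j), ← Finset.sum_sub_distrib]
    have e2 : Gs (P₁ j) - Gs (Q₁ j) = ∑ T : Set ι, (G (Φ T (P₁ j)) - G (Ψ T (Q₁ j))) := by
      show (∑ T : Set ι, G (Φ T (P₁ j))) - (∑ T : Set ι, G (Φ T (Q₁ j))) = _
      rw [← hΨavg G (Q₁ j), ← Finset.sum_sub_distrib]
    rw [e1, e2]
    refine harris_uniform_cov (a := fun T => F (Φ T (P₁ j)) - F (Ψ T (Q₁ j))) (b := fun T => G (Φ T (P₁ j)) - G (Ψ T (Q₁ j))) ?_ ?_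
    · exact fun T T' hTT' => sub_le_sub (hF (hΦT (P₁ j) hTT')) (hF (hΨT (Q₁ j) hTT'))
    · exact fun T T' hTT' => sub_le_sub (hG (hΦT (P₁ j) hTT')) (hG (hΨT (Q₁ j) hTT'))
  have hsum : ∑ j ∈ Finset.univ.filter (fun j => p j), (Fs (P₁ j) - Fs (Q₁ j)) * (Gs (P₁ j) - Gs (Q₁ j)) ≤
      (Fintype.card (Set ι) : ℝ) * ∑ j ∈ Finset.univ.filter (fun j => p j), ∑ T : Set ι,
        (F (Φ T (P₁ j)) - F (Ψ T (Q₁ j))) * (G (Φ T (P₁ j)) - G (Ψ T (Q₁ j))) := by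
    rw [Finset.mul_sum]
    exact Finset.sum_le_sum fun j _ => hj j
  exact (mul_nonneg_iff_of_pos_left hN).1 (le_trans hpos hsum)

namespace OneSum

variable {V : Type*} [Fintype V] {E₁ E₂ : Set (Sym2 V)} {s a : V}
  (hsep : ∀ e₁ ∈ E₁, ∀ e₂ ∈ E₂, ∀ v : V, v ∈ e₁ → v ∈ e₂ → v = a) (hs : ∀ e ∈ E₂, s ∈ e → s = a) (hdis : Disjoint E₁ E₂)
include hsep hs hdis

/-- **The doubling identity of the 1-sum** (any pair functional `Ψ`, any event depending on `ω ∩ E₁`):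
`|Set (Sym2 V)| · Σ_{ω : pred ω} Ψ(X ω, Y ω) = Σ_{ω₁ : pred ω₁} Σ_{ω₂} Ψ(L(X₁ ω₁, C_a(ω₂ ∩ E₂)), L(Y₁ ω₁, C_a(ω₂ᶜ ∩ E₂)))`
with `L(P,S) = P ∪ {u | a ∈ P ∧ u ∈ S}` (grafting the `E₂`-part of a second colouring). [this work] -/
theorem double_sum_eq (pred : Set (Sym2 V) → Prop) [DecidablePred pred]
    (hpred : ∀ ω ω' : Set (Sym2 V), ω ∩ E₁ = ω' ∩ E₁ → (pred ω ↔ pred ω')) (Ψ : Set V → Set V → ℝ) :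
    (Fintype.card (Set (Sym2 V)) : ℝ) * ∑ ω ∈ Finset.univ.filter (fun ω : Set (Sym2 V) => pred ω),
        Ψ (openCluster (ω ∩ (E₁ ∪ E₂)) s) (openCluster (ωᶜ ∩ (E₁ ∪ E₂)) s) =
      ∑ ω₁ ∈ Finset.univ.filter (fun ω : Set (Sym2 V) => pred ω), ∑ ω₂ : Set (Sym2 V),
        Ψ (openCluster (ω₁ ∩ E₁) s ∪ {u | a ∈ openCluster (ω₁ ∩ E₁) s ∧ u ∈ openCluster (ω₂ ∩ E₂) a})
          (openCluster (ω₁ᶜ ∩ E₁) s ∪ {u | a ∈ openCluster (ω₁ᶜ ∩ E₁) s ∧ u ∈ openCluster (ω₂ᶜ ∩ E₂) a}) := by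
  let X₁ : Set (Sym2 V) → Set V := fun ω => openCluster (ω ∩ E₁) s
  let Y₁ : Set (Sym2 V) → Set V := fun ω => openCluster (ωᶜ ∩ E₁) s
  let A : Set (Sym2 V) → Set V := fun ω => openCluster (ω ∩ E₂) a
  let B : Set (Sym2 V) → Set V := fun ω => openCluster (ωᶜ ∩ E₂) a
  let L : Set V → Set V → Set V := fun P S => P ∪ {u | a ∈ P ∧ u ∈ S}
  let Ψ₂ : Set (Sym2 V) → Set (Sym2 V) → ℝ := fun ω₁ ω₂ =>
    if pred ω₁ then Ψ (L (X₁ ω₁) (A ω₂)) (L (Y₁ ω₁) (B ω₂)) else 0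
  have hdis' : ∀ e, e ∈ E₁ → e ∉ E₂ := fun e h1 h2 => Set.disjoint_left.1 hdis h1 h2
  -- the left sum is the diagonal of `Ψ₂`
  have hdiag : ∑ ω ∈ Finset.univ.filter (fun ω : Set (Sym2 V) => pred ω),
      Ψ (openCluster (ω ∩ (E₁ ∪ E₂)) s) (openCluster (ωᶜ ∩ (E₁ ∪ E₂)) s) = ∑ ω, Ψ₂ ω ω := by
    rw [Finset.sum_filter]
    refine Finset.sum_congr rfl fun ω _ => ?_
    have e1 : openCluster (ω ∩ (E₁ ∪ E₂)) s = L (X₁ ω) (A ω) := cluster_eq hsep hs ω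
    have e2 : openCluster (ωᶜ ∩ (E₁ ∪ E₂)) s = L (Y₁ ω) (B ω) := cluster_eq hsep hs ωᶜ
    rw [e1, e2]
  -- the right sum is the full double sum of `Ψ₂`
  have hright : ∑ ω₁ ∈ Finset.univ.filter (fun ω : Set (Sym2 V) => pred ω), ∑ ω₂ : Set (Sym2 V),
        Ψ (L (X₁ ω₁) (A ω₂)) (L (Y₁ ω₁) (B ω₂)) = ∑ ω₁, ∑ ω₂, Ψ₂ ω₁ ω₂ := by
    rw [Finset.sum_filter]
    refine Finset.sum_congr rfl fun ω₁ _ => ?_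
    by_cases h : pred ω₁
    · simp only [Ψ₂, h, if_true]
    · simp only [Ψ₂, h, if_false, Finset.sum_const_zero]
  -- grafting
  let θ : Set (Sym2 V) × Set (Sym2 V) → Set (Sym2 V) × Set (Sym2 V) :=
    fun p => ((p.1 \ E₂) ∪ (p.2 ∩ E₂), (p.2 \ E₂) ∪ (p.1 ∩ E₂))
  have hθ : Function.Involutive θ := fun p => Cut.graft_graft E₂ p
  have g1 : ∀ c d : Set (Sym2 V), ((c \ E₂) ∪ (d ∩ E₂)) ∩ E₁ = c ∩ E₁ := by
    intro c d; ext e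
    simp only [Set.mem_inter_iff, Set.mem_union, Set.mem_sdiff]
    constructor
    · rintro ⟨h | h, he⟩
      · exact ⟨h.1, he⟩
      · exact absurd h.2 (hdis' e he)
    · rintro ⟨hc, he⟩; exact ⟨Or.inl ⟨hc, hdis' e he⟩, he⟩
  have g2 : ∀ c d : Set (Sym2 V), ((c \ E₂) ∪ (d ∩ E₂))ᶜ ∩ E₁ = cᶜ ∩ E₁ := by
    intro c d; ext e
    simp only [Set.mem_inter_iff, Set.mem_compl_iff, Set.mem_union, Set.mem_sdiff, not_or, not_and, not_not]
    constructor
    · rintro ⟨⟨h1, _⟩, he⟩; exact ⟨fun hc => hdis' e he (h1 hc), he⟩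
    · rintro ⟨hc, he⟩; exact ⟨⟨fun hc' => absurd hc' hc, fun _ he2 => absurd he2 (hdis' e he)⟩, he⟩
  have hΨθ : ∀ p : Set (Sym2 V) × Set (Sym2 V), Ψ₂ p.1 p.2 = Ψ₂ (θ p).1 (θ p).1 := by
    intro p
    have a0 : pred (θ p).1 ↔ pred p.1 := hpred _ _ (g1 p.1 p.2)
    have a1 : X₁ (θ p).1 = X₁ p.1 := by show openCluster (((p.1 \ E₂) ∪ (p.2 ∩ E₂)) ∩ E₁) s = _; rw [g1]
    have a2 : Y₁ (θ p).1 = Y₁ p.1 := by show openCluster (((p.1 \ E₂) ∪ (p.2 ∩ E₂))ᶜ ∩ E₁) s = _; rw [g2]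
    have a3 : A (θ p).1 = A p.2 := by
      show openCluster (((p.1 \ E₂) ∪ (p.2 ∩ E₂)) ∩ E₂) a = _; rw [(Cut.graft_inter_right p.1 p.2).1]
    have a4 : B (θ p).1 = B p.2 := by
      show openCluster (((p.1 \ E₂) ∪ (p.2 ∩ E₂))ᶜ ∩ E₂) a = _; rw [(Cut.graft_inter_right p.1 p.2).2]
    simp only [Ψ₂, a0, a1, a2, a3, a4]
  have hrel : ∑ ω₁, ∑ ω₂, Ψ₂ ω₁ ω₂ = (Fintype.card (Set (Sym2 V)) : ℝ) * ∑ ω, Ψ₂ ω ω := by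
    rw [← Fintype.sum_prod_type']
    rw [show ∑ p : Set (Sym2 V) × Set (Sym2 V), Ψ₂ p.1 p.2 = ∑ p : Set (Sym2 V) × Set (Sym2 V), Ψ₂ (θ p).1 (θ p).1 from
      Fintype.sum_congr _ _ hΨθ]
    rw [Fintype.sum_bijective θ hθ.bijective (fun p => Ψ₂ (θ p).1 (θ p).1) (fun q => Ψ₂ q.1 q.1) (fun p => rfl)]
    rw [Fintype.sum_prod_type, Finset.mul_sum]
    refine Finset.sum_congr rfl fun c _ => ?_
    show ∑ _d : Set (Sym2 V), Ψ₂ c c = _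
    rw [Finset.sum_const, Finset.card_univ, nsmul_eq_mul]
  rw [hdiag, hright, hrel]

/-- **BIC is 1-sum stable (vertex version).**  `R` a set of vertices of the `E₁` side (on a pair of `E₂` only if `= a`).  If
`Σ_{ω : no r ∈ R in X_{E₁} ∩ Y_{E₁}} (F(X_{E₁} ω) − F(Y_{E₁} ω))(G(X_{E₁} ω) − G(Y_{E₁} ω)) ≥ 0` for all monotone `F, G`, then the same holds
with the clusters of `E₁ ∪ E₂`. [this work] -/
theorem vertex_sum_nonneg (R : Set V) (hR : ∀ r ∈ R, ∀ e ∈ E₂, r ∈ e → r = a)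
    (hbic : ∀ F G : Set V → ℝ, Monotone F → Monotone G →
      0 ≤ ∑ ω ∈ Finset.univ.filter (fun ω : Set (Sym2 V) =>
          ∀ r ∈ R, ¬ (r ∈ openCluster (ω ∩ E₁) s ∧ r ∈ openCluster (ωᶜ ∩ E₁) s)),
        (F (openCluster (ω ∩ E₁) s) - F (openCluster (ωᶜ ∩ E₁) s)) * (G (openCluster (ω ∩ E₁) s) - G (openCluster (ωᶜ ∩ E₁) s)))
    {F G : Set V → ℝ} (hF : Monotone F) (hG : Monotone G) :
    0 ≤ ∑ ω ∈ Finset.univ.filter (fun ω : Set (Sym2 V) =>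
        ∀ r ∈ R, ¬ (r ∈ openCluster (ω ∩ (E₁ ∪ E₂)) s ∧ r ∈ openCluster (ωᶜ ∩ (E₁ ∪ E₂)) s)),
      (F (openCluster (ω ∩ (E₁ ∪ E₂)) s) - F (openCluster (ωᶜ ∩ (E₁ ∪ E₂)) s)) *
        (G (openCluster (ω ∩ (E₁ ∪ E₂)) s) - G (openCluster (ωᶜ ∩ (E₁ ∪ E₂)) s)) := by
  -- the event is the same for `E₁` and `E₁ ∪ E₂` (`R` on the `E₁` side)
  have hev : ∀ (η : Set (Sym2 V)), ∀ r ∈ R, r ∈ openCluster (η ∩ (E₁ ∪ E₂)) s ↔ r ∈ openCluster (η ∩ E₁) s :=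
    fun η r hr => Glue.reach_side_one s hsep hs (hR r hr)
  have hfilter : Finset.univ.filter (fun ω : Set (Sym2 V) =>
        ∀ r ∈ R, ¬ (r ∈ openCluster (ω ∩ (E₁ ∪ E₂)) s ∧ r ∈ openCluster (ωᶜ ∩ (E₁ ∪ E₂)) s)) =
      Finset.univ.filter (fun ω : Set (Sym2 V) => ∀ r ∈ R, ¬ (r ∈ openCluster (ω ∩ E₁) s ∧ r ∈ openCluster (ωᶜ ∩ E₁) s)) := by
    refine Finset.filter_congr fun ω _ => ?_
    refine forall₂_congr fun r hr => ?_
    rw [hev ω r hr, hev ωᶜ r hr]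
  rw [hfilter]
  -- doubling, then lift composition for differences over the exactly antipodal cluster cube of `a` in `E₂`
  have hpred : ∀ ω ω' : Set (Sym2 V), ω ∩ E₁ = ω' ∩ E₁ →
      ((∀ r ∈ R, ¬ (r ∈ openCluster (ω ∩ E₁) s ∧ r ∈ openCluster (ωᶜ ∩ E₁) s)) ↔
        (∀ r ∈ R, ¬ (r ∈ openCluster (ω' ∩ E₁) s ∧ r ∈ openCluster (ω'ᶜ ∩ E₁) s))) := by
    intro ω ω' h
    have h' : ωᶜ ∩ E₁ = ω'ᶜ ∩ E₁ := by
      ext e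
      simp only [Set.mem_inter_iff, Set.mem_compl_iff]
      constructor
      · rintro ⟨h1, he⟩
        exact ⟨fun h2 => h1 (by have : e ∈ ω' ∩ E₁ := ⟨h2, he⟩; rw [← h] at this; exact this.1), he⟩
      · rintro ⟨h1, he⟩
        exact ⟨fun h2 => h1 (by have : e ∈ ω ∩ E₁ := ⟨h2, he⟩; rw [h] at this; exact this.1), he⟩
    rw [h, h']
  have hN : (0 : ℝ) < (Fintype.card (Set (Sym2 V)) : ℝ) := by exact_mod_cast Fintype.card_pos
  have key := double_sum_eq hsep hs hdis (fun ω => ∀ r ∈ R, ¬ (r ∈ openCluster (ω ∩ E₁) s ∧ r ∈ openCluster (ωᶜ ∩ E₁) s))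
    hpred (fun P Q => (F P - F Q) * (G P - G Q))
  have hdbl : 0 ≤ ∑ ω₁ ∈ Finset.univ.filter (fun ω : Set (Sym2 V) =>
        ∀ r ∈ R, ¬ (r ∈ openCluster (ω ∩ E₁) s ∧ r ∈ openCluster (ωᶜ ∩ E₁) s)), ∑ ω₂ : Set (Sym2 V),
      (F (openCluster (ω₁ ∩ E₁) s ∪ {u | a ∈ openCluster (ω₁ ∩ E₁) s ∧ u ∈ openCluster (ω₂ ∩ E₂) a}) -
          F (openCluster (ω₁ᶜ ∩ E₁) s ∪ {u | a ∈ openCluster (ω₁ᶜ ∩ E₁) s ∧ u ∈ openCluster (ω₂ᶜ ∩ E₂) a})) *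
        (G (openCluster (ω₁ ∩ E₁) s ∪ {u | a ∈ openCluster (ω₁ ∩ E₁) s ∧ u ∈ openCluster (ω₂ ∩ E₂) a}) -
          G (openCluster (ω₁ᶜ ∩ E₁) s ∪ {u | a ∈ openCluster (ω₁ᶜ ∩ E₁) s ∧ u ∈ openCluster (ω₂ᶜ ∩ E₂) a})) := by
    refine lift_composition_diff_nonneg (fun ω : Set (Sym2 V) => ∀ r ∈ R, ¬ (r ∈ openCluster (ω ∩ E₁) s ∧ r ∈ openCluster (ωᶜ ∩ E₁) s))
      (fun ω => openCluster (ω ∩ E₁) s) (fun ω => openCluster (ωᶜ ∩ E₁) s) hbic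
      (fun T P => P ∪ {u | a ∈ P ∧ u ∈ openCluster (T ∩ E₂) a}) (fun T Q => Q ∪ {u | a ∈ Q ∧ u ∈ openCluster (Tᶜ ∩ E₂) a})
      ?_ ?_ ?_ ?_ hF hG
    · intro T P P' hP u hu
      rcases hu with hu | ⟨ha, hu⟩
      · exact Or.inl (hP hu)
      · exact Or.inr ⟨hP ha, hu⟩
    · intro P T T' hTT' u hu
      rcases hu with hu | ⟨ha, hu⟩
      · exact Or.inl hu
      · exact Or.inr ⟨ha, Freeze.openCluster_mono (Set.inter_subset_inter_left E₂ hTT') a hu⟩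
    · intro Q T T' hTT' u hu
      rcases hu with hu | ⟨ha, hu⟩
      · exact Or.inl hu
      · exact Or.inr ⟨ha, Freeze.openCluster_mono (Set.inter_subset_inter_left E₂ (Set.compl_subset_compl.2 hTT')) a hu⟩
    · intro T P
      show P ∪ {u | a ∈ P ∧ u ∈ openCluster (Tᶜᶜ ∩ E₂) a} = P ∪ {u | a ∈ P ∧ u ∈ openCluster (T ∩ E₂) a}
      rw [compl_compl]
  rw [← key] at hdbl
  exact (mul_nonneg_iff_of_pos_left hN).1 hdbl

end OneSum

end Antithetic

end Summit.CriticalPhenomena.PercolationContinuityZ3.Theorems
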